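import Summits.FinalStateConjecture.FinalStateConjecture.Theorems.PhotonSphereChannelsExteriorEnergyRW

/-!
# Route PhotonSphereChannels — stability of outgoing energy exhaustion under energy-small perturbations

Helper file for the sub-goal `stub_exhaustionDensity` of stub `stub_outgoingEnergyExhaustion` (H4) of
line `isolated-kerr-connected-hull` (crux stmt-FinalStateConjecture-14075), over the Literature vocabulary
`ReggeWheeler.{energyDensity, IsSolution, exteriorEnergy, channelEnergy, totalEnergy}`:

* `RW.energyDensity_add_le` — `e[φ + w] ≤ 2 e[φ] + 2 e[w]` pointwise (`V ≥ 0`);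
* `RW.totalEnergy_add_exteriorEnergy_le` — for global solutions `ψ = φ + w` and every centre `T` and
  time `t`: `E(ψ) + 2 E_ext[φ(T+·)](t) ≤ E_ext[ψ(T+·)](t) + 2 E(φ) + 2 E(w)` (conservation of the total
  energy and the split of the line at the cone `{|x − xc| = t}`: the energy of `ψ` INSIDE the cone is at
  most twice those of `φ` and `w`);
* `RW.exhaustion_of_energy_approx` — **stability**: if for every `ε > 0` one can write `ψ = φ + w` with
  solutions `φ, w`, `E(w) ≤ ε`, `E(φ) < ⊤` and `chan_T(φ) → E(φ)` (`T → +∞`), then `chan_T(ψ) → E(ψ)`,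
  where `chan_T(u)` is the forward channel energy of `u(T + ·)` through the bare cone about `xc`
  (`t → ∞` then `T → ∞` in the previous inequality gives `E(ψ) ≤ sup_T chan_T(ψ) + 2ε`; the silence
  functional is monotone in `T` and `≤ E(ψ)`);
* the registered summary `stub_h4ExhaustionStability`.

(Energy conservation — public in `…RTotalEnergyConservation` — and the time-shift lemmas — public in
`…RSilenceReduction` — are re-derived here as `private` lemmas so that this file does not depend on those
modules' build.)  No new definitions; standard material. [folklore]
-/

namespace Summit.FinalStateConjecture.FinalStateConjecture.Theorems

-- every `Summit.FinalStateConjecture.FinalStateConjecture.…` name repeats the summit = sub-problem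
-- segment (D-0017 layout), as in every landed `…Theorems` file of this route
set_option linter.dupNamespace false

open MeasureTheory Set Filter Topology Metric
open scoped ENNReal
open Literature.Geometry.Lorentzian Literature.Geometry.Lorentzian.ReggeWheeler

noncomputable section

namespace RW

variable {V : ℝ → ℝ} {ψ φ w : ℝ → ℝ → ℝ}

/-! ### Private copies of energy conservation (public: `…RTotalEnergyConservation`) and of the
time-shift lemmas (public: `…RSilenceReduction`) — those modules are not yet built on the farm -/

/-- Dictionary (`he` format of the `WaveEnergy` files). -/
private theorem energyDensity_he₀ (hψ : ContDiff ℝ 2 (Function.uncurry ψ)) :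
    ∀ z : ℝ × ℝ, (fun z : ℝ × ℝ ↦ energyDensity V ψ z.1 z.2) z
      = (fderiv ℝ (Function.uncurry ψ) z (1, 0)) ^ 2 + (fderiv ℝ (Function.uncurry ψ) z (0, 1)) ^ 2
        + V z.2 * Function.uncurry ψ z ^ 2 := by
  rintro ⟨t, x⟩
  simp only [Function.uncurry_apply_pair]
  unfold energyDensity
  rw [WaveEnergy.deriv_slice_fst_eq hψ, WaveEnergy.deriv_slice_snd_eq hψ]

/-- The energy density at a fixed time is continuous in `x` (private copy of
`RW.continuous_energyDensity_slice`). -/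
private theorem continuous_energyDensity_slice₂ (hV : Differentiable ℝ V)
    (hψ : ContDiff ℝ 2 (Function.uncurry ψ)) (t : ℝ) :
    Continuous (fun x ↦ energyDensity V ψ t x) :=
  (WaveEnergy.continuous_energyDensity hψ hV (energyDensity_he₀ hψ)).comp (Continuous.prodMk_right t)

/-- Dictionary (`hsol` format of the `WaveEnergy` files). -/
private theorem fderiv_eq₀ (hψ : IsSolution V ψ) :
    ∀ z : ℝ × ℝ, fderiv ℝ (fderiv ℝ (Function.uncurry ψ)) z (1, 0) (1, 0)
      - fderiv ℝ (fderiv ℝ (Function.uncurry ψ)) z (0, 1) (0, 1) + V z.2 * Function.uncurry ψ z = 0 := by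
  rintro ⟨t, x⟩
  rw [← WaveEnergy.iteratedDeriv_two_slice_fst_eq hψ.1, ← WaveEnergy.iteratedDeriv_two_slice_snd_eq hψ.1]
  exact hψ.2 (t, x)

/-- Half-line energies are bounded by the total energy at any other time. -/
private theorem setLIntegral_Ioi_le_totalEnergy₀ (hV : Differentiable ℝ V) (hV0 : ∀ x, 0 ≤ V x)
    (hψ : IsSolution V ψ) (c t₁ t₂ : ℝ) :
    ∫⁻ x in Ioi c, ENNReal.ofReal (energyDensity V ψ t₁ x) ≤ totalEnergy V ψ t₂ := by
  have he := energyDensity_he₀ (V := V) hψ.1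
  have hsol := fderiv_eq₀ hψ
  rcases le_total t₁ t₂ with h | h
  · exact (WaveEnergy.lintegral_Ioi_le_expanding hψ.1 hV hV0 hsol he c h).trans
      (setLIntegral_le_lintegral _ _)
  · have key := WaveEnergy.lintegral_Ioi_shrinking_le hψ.1 hV hV0 hsol he (c - (t₁ - t₂)) h
    have e1 : c - (t₁ - t₂) + (t₁ - t₂) = c := by ring
    rw [e1] at key
    exact key.trans (setLIntegral_le_lintegral _ _)

/-- Conservation of the total energy (private copy of `RW.totalEnergy_eq_totalEnergy`). -/
private theorem totalEnergy_eq_totalEnergy₀ (hV : Differentiable ℝ V) (hV0 : ∀ x, 0 ≤ V x)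
    (hψ : IsSolution V ψ) (t₁ t₂ : ℝ) : totalEnergy V ψ t₁ = totalEnergy V ψ t₂ := by
  have hdir : Directed (· ⊆ ·) (fun n : ℕ ↦ Ioi (-(n : ℝ))) := by
    refine Monotone.directed_le fun i j hij ↦ Ioi_subset_Ioi ?_
    exact neg_le_neg (Nat.cast_le.mpr hij)
  have hU : (⋃ n : ℕ, Ioi (-(n : ℝ))) = univ := by
    refine eq_univ_of_forall fun x ↦ ?_
    obtain ⟨n, hn⟩ := exists_nat_gt (-x)
    exact mem_iUnion.2 ⟨n, by simp only [mem_Ioi]; linarith⟩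
  have hsup : ∀ t, totalEnergy V ψ t
      = ⨆ n : ℕ, ∫⁻ x in Ioi (-(n : ℝ)), ENNReal.ofReal (energyDensity V ψ t x) := fun t ↦ by
    unfold totalEnergy
    rw [← setLIntegral_univ, ← hU, setLIntegral_iUnion_of_directed _ hdir]
  apply le_antisymm
  · rw [hsup t₁]
    exact iSup_le fun n ↦ setLIntegral_Ioi_le_totalEnergy₀ hV hV0 hψ _ t₁ t₂
  · rw [hsup t₂]
    exact iSup_le fun n ↦ setLIntegral_Ioi_le_totalEnergy₀ hV hV0 hψ _ t₂ t₁

/-- Time shifts of global solutions are global solutions (private copy of `RW.IsSolution.shift`). -/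
private theorem isSolution_shift₀ (hψ : IsSolution V ψ) (T : ℝ) :
    IsSolution V (fun s y ↦ ψ (T + s) y) := by
  refine ⟨?_, fun z ↦ ?_⟩
  · have h : Function.uncurry (fun s y ↦ ψ (T + s) y)
        = Function.uncurry ψ ∘ fun p : ℝ × ℝ ↦ (T + p.1, p.2) := by
      funext p
      rfl
    rw [h]
    exact hψ.1.comp ((contDiff_const.add contDiff_fst).prodMk contDiff_snd)
  · show iteratedDeriv 2 (fun τ ↦ ψ (T + τ) z.2) z.1 - iteratedDeriv 2 (fun y ↦ ψ (T + z.1) y) z.2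
      + V z.2 * ψ (T + z.1) z.2 = 0
    rw [iteratedDeriv_comp_const_add 2 (fun τ ↦ ψ τ z.2) T]
    exact hψ.2 (T + z.1, z.2)

/-- Energy density of the time-shifted function (private copy of `RW.energyDensity_shift`). -/
private theorem energyDensity_shift₀ (V : ℝ → ℝ) (ψ : ℝ → ℝ → ℝ) (T t x : ℝ) :
    energyDensity V (fun s y ↦ ψ (T + s) y) t x = energyDensity V ψ (T + t) x := by
  unfold energyDensity
  rw [deriv_comp_const_add (fun σ ↦ ψ σ x) T t]

/-- Later cones are narrower (private copy of `RW.exteriorEnergy_shift_mono`). -/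
private theorem exteriorEnergy_shift_mono₀ (V : ℝ → ℝ) (ψ : ℝ → ℝ → ℝ) (xc T : ℝ) {Δ t : ℝ}
    (hΔ : 0 ≤ Δ) (ht : 0 ≤ t) :
    exteriorEnergy V xc 0 (fun s y ↦ ψ (T + s) y) (t + Δ)
      ≤ exteriorEnergy V xc 0 (fun s y ↦ ψ (T + Δ + s) y) t := by
  unfold exteriorEnergy
  have hsub : {x : ℝ | 0 + |t + Δ| < |x - xc|} ⊆ {x : ℝ | 0 + |t| < |x - xc|} := by
    intro x hx
    simp only [mem_setOf_eq] at hx ⊢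
    rw [abs_of_nonneg (by linarith : 0 ≤ t + Δ)] at hx
    rw [abs_of_nonneg ht]
    linarith
  calc ∫⁻ x in {x : ℝ | 0 + |t + Δ| < |x - xc|},
        ENNReal.ofReal (energyDensity V (fun s y ↦ ψ (T + s) y) (t + Δ) x)
      = ∫⁻ x in {x : ℝ | 0 + |t + Δ| < |x - xc|},
        ENNReal.ofReal (energyDensity V (fun s y ↦ ψ (T + Δ + s) y) t x) := by
        refine lintegral_congr fun x ↦ ?_
        rw [energyDensity_shift₀, energyDensity_shift₀, show T + (t + Δ) = T + Δ + t by ring]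
    _ ≤ _ := lintegral_mono_set hsub

/-- The silence functional is non-decreasing in the centre (private copy of
`RW.channelEnergy_shift_mono`). -/
private theorem channelEnergy_shift_mono₀ (V : ℝ → ℝ) (ψ : ℝ → ℝ → ℝ) (xc : ℝ) {T₁ T₂ : ℝ}
    (hT : T₁ ≤ T₂) :
    channelEnergy V xc 0 (fun s y ↦ ψ (T₁ + s) y) atTop
      ≤ channelEnergy V xc 0 (fun s y ↦ ψ (T₂ + s) y) atTop := by
  unfold channelEnergy
  set Δ := T₂ - T₁ with hΔ
  have hΔ0 : 0 ≤ Δ := sub_nonneg.2 hT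
  have hT2 : T₂ = T₁ + Δ := by rw [hΔ]; ring
  have h1 : liminf (exteriorEnergy V xc 0 (fun s y ↦ ψ (T₁ + s) y)) atTop
      = liminf ((exteriorEnergy V xc 0 (fun s y ↦ ψ (T₁ + s) y)) ∘ fun t ↦ t + Δ) atTop := by
    rw [liminf_comp, map_add_atTop_eq]
  rw [h1]
  refine liminf_le_liminf ?_
  filter_upwards [eventually_ge_atTop (0 : ℝ)] with t ht
  rw [Function.comp_apply, hT2]
  exact exteriorEnergy_shift_mono₀ V ψ xc T₁ hΔ0 ht

/-- The silence functional is bounded by the total energy (private copy of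
`RW.channelEnergy_shift_le_totalEnergy`). -/
private theorem channelEnergy_shift_le_totalEnergy₀ (hV : Differentiable ℝ V) (hV0 : ∀ x, 0 ≤ V x)
    (hψ : IsSolution V ψ) (xc T : ℝ) :
    channelEnergy V xc 0 (fun s y ↦ ψ (T + s) y) atTop ≤ totalEnergy V ψ 0 := by
  unfold channelEnergy
  refine liminf_le_of_frequently_le (Frequently.of_forall fun t ↦ ?_)
  calc exteriorEnergy V xc 0 (fun s y ↦ ψ (T + s) y) t
      ≤ totalEnergy V (fun s y ↦ ψ (T + s) y) t := exteriorEnergy_le_totalEnergy V xc 0 _ t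
    _ = totalEnergy V ψ (T + t) := by
        unfold totalEnergy
        exact lintegral_congr fun x ↦ by rw [energyDensity_shift₀]
    _ = totalEnergy V ψ 0 := totalEnergy_eq_totalEnergy₀ hV hV0 hψ (T + t) 0

/-- The silence functional has a limit (its supremum) as the centre tends to `+∞` (private copy of
`RW.tendsto_channelEnergy_shift`). -/
private theorem tendsto_channelEnergy_shift₀ (V : ℝ → ℝ) (ψ : ℝ → ℝ → ℝ) (xc : ℝ) :
    Tendsto (fun T ↦ channelEnergy V xc 0 (fun s y ↦ ψ (T + s) y) atTop) atTop
      (𝓝 (⨆ T, channelEnergy V xc 0 (fun s y ↦ ψ (T + s) y) atTop)) :=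
  tendsto_atTop_iSup fun _ _ h ↦ channelEnergy_shift_mono₀ V ψ xc h

/-! ### The energy of a sum and the stability of exhaustion -/

/-- **The energy density of a sum**: for `C²` functions `φ, w` and `ψ = φ + w`,
`e[ψ] ≤ 2 e[φ] + 2 e[w]` wherever `V ≥ 0`. [folklore] -/
theorem energyDensity_add_le (hφ : ContDiff ℝ 2 (Function.uncurry φ))
    (hw : ContDiff ℝ 2 (Function.uncurry w)) (hsum : ∀ t x, ψ t x = φ t x + w t x) (t : ℝ) {x : ℝ}
    (hV : 0 ≤ V x) :
    energyDensity V ψ t x ≤ 2 * energyDensity V φ t x + 2 * energyDensity V w t x := by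
  have hf1 : (fun τ ↦ ψ τ x) = fun τ ↦ φ τ x + w τ x := funext fun τ ↦ hsum τ x
  have hf2 : ψ t = fun y ↦ φ t y + w t y := funext fun y ↦ hsum t y
  have hd1 : HasDerivAt (fun τ ↦ φ τ x + w τ x) (fderiv ℝ (Function.uncurry φ) (t, x) (1, 0)
      + fderiv ℝ (Function.uncurry w) (t, x) (1, 0)) t :=
    (WaveEnergy.hasDerivAt_slice_fst (WaveEnergy.differentiable_of_contDiff_two hφ) t x).add
      (WaveEnergy.hasDerivAt_slice_fst (WaveEnergy.differentiable_of_contDiff_two hw) t x)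
  have hd2 : HasDerivAt (fun y ↦ φ t y + w t y) (fderiv ℝ (Function.uncurry φ) (t, x) (0, 1)
      + fderiv ℝ (Function.uncurry w) (t, x) (0, 1)) x :=
    (WaveEnergy.hasDerivAt_slice_snd (WaveEnergy.differentiable_of_contDiff_two hφ) t x).add
      (WaveEnergy.hasDerivAt_slice_snd (WaveEnergy.differentiable_of_contDiff_two hw) t x)
  unfold energyDensity
  rw [hf1, hf2, hd1.deriv, hd2.deriv, WaveEnergy.deriv_slice_fst_eq hφ, WaveEnergy.deriv_slice_fst_eq hw,
    WaveEnergy.deriv_slice_snd_eq hφ, WaveEnergy.deriv_slice_snd_eq hw]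
  nlinarith [sq_nonneg (fderiv ℝ (Function.uncurry φ) (t, x) (1, 0)
      - fderiv ℝ (Function.uncurry w) (t, x) (1, 0)),
    sq_nonneg (fderiv ℝ (Function.uncurry φ) (t, x) (0, 1)
      - fderiv ℝ (Function.uncurry w) (t, x) (0, 1)),
    mul_nonneg hV (sq_nonneg (φ t x - w t x))]

/-- **Splitting the conserved energy at the cone.** For global solutions `ψ = φ + w` (`V ≥ 0`
differentiable) and every centre `T` and time `t`:
`E(ψ) + 2 E_ext[φ(T+·)](t) ≤ E_ext[ψ(T+·)](t) + 2 E(φ) + 2 E(w)` (energies at time `0`; the energy of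
`ψ` inside the cone at time `T + t` is at most twice those of `φ` and `w`). [folklore] -/
theorem totalEnergy_add_exteriorEnergy_le (hV : Differentiable ℝ V) (hV0 : ∀ x, 0 ≤ V x)
    (hψ : IsSolution V ψ) (hφ : IsSolution V φ) (hw : IsSolution V w)
    (hsum : ∀ t x, ψ t x = φ t x + w t x) (xc T t : ℝ) :
    totalEnergy V ψ 0 + 2 * exteriorEnergy V xc 0 (fun s y ↦ φ (T + s) y) t
      ≤ exteriorEnergy V xc 0 (fun s y ↦ ψ (T + s) y) t + 2 * totalEnergy V φ 0
        + 2 * totalEnergy V w 0 := by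
  have hA : MeasurableSet {x : ℝ | 0 + |t| < |x - xc|} :=
    measurableSet_lt measurable_const (continuous_abs.comp (continuous_sub_right xc)).measurable
  have hext : ∀ u : ℝ → ℝ → ℝ, exteriorEnergy V xc 0 (fun s y ↦ u (T + s) y) t
      = ∫⁻ x in {x : ℝ | 0 + |t| < |x - xc|}, ENNReal.ofReal (energyDensity V u (T + t) x) :=
    fun u ↦ lintegral_congr fun x ↦ by rw [energyDensity_shift₀]
  have hcons : ∀ u : ℝ → ℝ → ℝ, IsSolution V u → totalEnergy V u 0
      = (∫⁻ x in {x : ℝ | 0 + |t| < |x - xc|}, ENNReal.ofReal (energyDensity V u (T + t) x))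
        + ∫⁻ x in {x : ℝ | 0 + |t| < |x - xc|}ᶜ, ENNReal.ofReal (energyDensity V u (T + t) x) :=
    fun u hu ↦ by
      rw [totalEnergy_eq_totalEnergy₀ hV hV0 hu 0 (T + t)]
      unfold totalEnergy
      rw [lintegral_add_compl _ hA]
  have hpt : ∀ x, ENNReal.ofReal (energyDensity V ψ (T + t) x)
      ≤ 2 * ENNReal.ofReal (energyDensity V φ (T + t) x)
        + 2 * ENNReal.ofReal (energyDensity V w (T + t) x) := fun x ↦ by
    have h := energyDensity_add_le (V := V) hφ.1 hw.1 hsum (T + t) (hV0 x)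
    have h0φ := energyDensity_nonneg (V := V) φ (T + t) (hV0 x)
    have h0w := energyDensity_nonneg (V := V) w (T + t) (hV0 x)
    calc ENNReal.ofReal (energyDensity V ψ (T + t) x)
        ≤ ENNReal.ofReal (2 * energyDensity V φ (T + t) x + 2 * energyDensity V w (T + t) x) :=
          ENNReal.ofReal_le_ofReal h
      _ = _ := by
          rw [ENNReal.ofReal_add (by positivity) (by positivity), ENNReal.ofReal_mul (by norm_num),
            ENNReal.ofReal_mul (by norm_num), ENNReal.ofReal_ofNat]
  have hmeas : Measurable fun x ↦ 2 * ENNReal.ofReal (energyDensity V φ (T + t) x) :=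
    (ENNReal.measurable_ofReal.comp
      (continuous_energyDensity_slice₂ hV hφ.1 (T + t)).measurable).const_mul 2
  have hin : ∫⁻ x in {x : ℝ | 0 + |t| < |x - xc|}ᶜ, ENNReal.ofReal (energyDensity V ψ (T + t) x)
      ≤ 2 * (∫⁻ x in {x : ℝ | 0 + |t| < |x - xc|}ᶜ, ENNReal.ofReal (energyDensity V φ (T + t) x))
        + 2 * (∫⁻ x in {x : ℝ | 0 + |t| < |x - xc|}ᶜ, ENNReal.ofReal (energyDensity V w (T + t) x)) := by
    calc ∫⁻ x in {x : ℝ | 0 + |t| < |x - xc|}ᶜ, ENNReal.ofReal (energyDensity V ψ (T + t) x)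
        ≤ ∫⁻ x in {x : ℝ | 0 + |t| < |x - xc|}ᶜ, (2 * ENNReal.ofReal (energyDensity V φ (T + t) x)
          + 2 * ENNReal.ofReal (energyDensity V w (T + t) x)) := lintegral_mono hpt
      _ = _ := by
          rw [lintegral_add_left hmeas, lintegral_const_mul' _ _ ENNReal.ofNat_ne_top,
            lintegral_const_mul' _ _ ENNReal.ofNat_ne_top]
  have hwE : ∫⁻ x in {x : ℝ | 0 + |t| < |x - xc|}ᶜ, ENNReal.ofReal (energyDensity V w (T + t) x)
      ≤ totalEnergy V w 0 := by
    rw [hcons w hw]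
    exact le_add_left le_rfl
  have alg : ∀ a b p q r : ℝ≥0∞, (a + (2 * p + 2 * q)) + 2 * b = a + 2 * (b + p) + 2 * q :=
    fun a b p q r ↦ by ring
  calc totalEnergy V ψ 0 + 2 * exteriorEnergy V xc 0 (fun s y ↦ φ (T + s) y) t
      = ((∫⁻ x in {x : ℝ | 0 + |t| < |x - xc|}, ENNReal.ofReal (energyDensity V ψ (T + t) x))
        + ∫⁻ x in {x : ℝ | 0 + |t| < |x - xc|}ᶜ, ENNReal.ofReal (energyDensity V ψ (T + t) x))
        + 2 * ∫⁻ x in {x : ℝ | 0 + |t| < |x - xc|}, ENNReal.ofReal (energyDensity V φ (T + t) x) := by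
        rw [← hcons ψ hψ, hext φ]
    _ ≤ ((∫⁻ x in {x : ℝ | 0 + |t| < |x - xc|}, ENNReal.ofReal (energyDensity V ψ (T + t) x))
        + (2 * (∫⁻ x in {x : ℝ | 0 + |t| < |x - xc|}ᶜ, ENNReal.ofReal (energyDensity V φ (T + t) x))
          + 2 * (∫⁻ x in {x : ℝ | 0 + |t| < |x - xc|}ᶜ, ENNReal.ofReal (energyDensity V w (T + t) x))))
        + 2 * ∫⁻ x in {x : ℝ | 0 + |t| < |x - xc|}, ENNReal.ofReal (energyDensity V φ (T + t) x) := by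
        gcongr
    _ = exteriorEnergy V xc 0 (fun s y ↦ ψ (T + s) y) t
        + 2 * ((∫⁻ x in {x : ℝ | 0 + |t| < |x - xc|}, ENNReal.ofReal (energyDensity V φ (T + t) x))
          + ∫⁻ x in {x : ℝ | 0 + |t| < |x - xc|}ᶜ, ENNReal.ofReal (energyDensity V φ (T + t) x))
        + 2 * ∫⁻ x in {x : ℝ | 0 + |t| < |x - xc|}ᶜ, ENNReal.ofReal (energyDensity V w (T + t) x) := by
        rw [hext ψ]
        exact alg _ _ _ _ 0
    _ = exteriorEnergy V xc 0 (fun s y ↦ ψ (T + s) y) t + 2 * totalEnergy V φ 0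
        + 2 * ∫⁻ x in {x : ℝ | 0 + |t| < |x - xc|}ᶜ, ENNReal.ofReal (energyDensity V w (T + t) x) := by
        rw [← hcons φ hφ]
    _ ≤ _ := by gcongr

/-- **Stability of outgoing energy exhaustion under energy-small perturbations.** Let `V ≥ 0` be
differentiable and `ψ` a global `C²` solution of finite energy.  If for every `ε > 0` one can write
`ψ = φ + w` with global solutions `φ, w` such that `E(w) ≤ ε`, `E(φ) < ⊤` and the forward channel
energy of `φ(T + ·)` through the bare cone about `xc` tends to `E(φ)` as `T → +∞`, then the same
exhaustion holds for `ψ`. [folklore] -/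
theorem exhaustion_of_energy_approx (hV : Differentiable ℝ V) (hV0 : ∀ x, 0 ≤ V x)
    (hψ : IsSolution V ψ) (xc : ℝ)
    (happrox : ∀ ε : ℝ, 0 < ε → ∃ φ w : ℝ → ℝ → ℝ, IsSolution V φ ∧ IsSolution V w ∧
      (∀ t x, ψ t x = φ t x + w t x) ∧ totalEnergy V φ 0 < ⊤ ∧
      totalEnergy V w 0 ≤ ENNReal.ofReal ε ∧
      Tendsto (fun T ↦ channelEnergy V xc 0 (fun t x ↦ φ (T + t) x) atTop) atTop
        (𝓝 (totalEnergy V φ 0))) :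
    Tendsto (fun T ↦ channelEnergy V xc 0 (fun t x ↦ ψ (T + t) x) atTop) atTop
      (𝓝 (totalEnergy V ψ 0)) := by
  have hlim := tendsto_channelEnergy_shift₀ V ψ xc
  suffices hLE : (⨆ T, channelEnergy V xc 0 (fun s y ↦ ψ (T + s) y) atTop) = totalEnergy V ψ 0 by
    rw [hLE] at hlim
    exact hlim
  apply le_antisymm (iSup_le fun T ↦ channelEnergy_shift_le_totalEnergy₀ hV hV0 hψ xc T)
  refine ENNReal.le_of_forall_pos_le_add fun ε hε _ ↦ ?_
  obtain ⟨φ, w, hφ, hw, hsum, hφE, hwE, hφlim⟩ := happrox (ε / 2) (by positivity)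
  -- per centre `T`: `E(ψ) + 2 chan_T(φ) ≤ L + (2 E(φ) + 2 E(w))`
  have hT : ∀ T, totalEnergy V ψ 0 + 2 * channelEnergy V xc 0 (fun t x ↦ φ (T + t) x) atTop
      ≤ (⨆ T, channelEnergy V xc 0 (fun s y ↦ ψ (T + s) y) atTop)
        + (2 * totalEnergy V φ 0 + 2 * totalEnergy V w 0) := by
    intro T
    have hcT : channelEnergy V xc 0 (fun s y ↦ ψ (T + s) y) atTop
        = ⨅ t ∈ Ici (0 : ℝ), exteriorEnergy V xc 0 (fun s y ↦ ψ (T + s) y) t :=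
      channelEnergy_atTop_eq_iInf hV hV0 (isSolution_shift₀ hψ T) xc le_rfl
    rw [channelEnergy_atTop_eq_iInf hV hV0 (isSolution_shift₀ hφ T) xc le_rfl]
    have key : ∀ t ∈ Ici (0 : ℝ), totalEnergy V ψ 0
        + 2 * (⨅ t ∈ Ici (0 : ℝ), exteriorEnergy V xc 0 (fun s y ↦ φ (T + s) y) t)
        ≤ exteriorEnergy V xc 0 (fun s y ↦ ψ (T + s) y) t
          + (2 * totalEnergy V φ 0 + 2 * totalEnergy V w 0) := fun t ht ↦
      calc totalEnergy V ψ 0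
            + 2 * (⨅ t ∈ Ici (0 : ℝ), exteriorEnergy V xc 0 (fun s y ↦ φ (T + s) y) t)
          ≤ totalEnergy V ψ 0 + 2 * exteriorEnergy V xc 0 (fun s y ↦ φ (T + s) y) t := by
            gcongr
            exact iInf₂_le t ht
        _ ≤ _ := by
            rw [← add_assoc]
            exact totalEnergy_add_exteriorEnergy_le hV hV0 hψ hφ hw hsum xc T t
    have h2 : totalEnergy V ψ 0
        + 2 * (⨅ t ∈ Ici (0 : ℝ), exteriorEnergy V xc 0 (fun s y ↦ φ (T + s) y) t)
        - (2 * totalEnergy V φ 0 + 2 * totalEnergy V w 0)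
        ≤ channelEnergy V xc 0 (fun s y ↦ ψ (T + s) y) atTop := by
      rw [hcT]
      exact le_iInf₂ fun t ht ↦ tsub_le_iff_right.2 (key t ht)
    have h3 : channelEnergy V xc 0 (fun s y ↦ ψ (T + s) y) atTop
        ≤ ⨆ T, channelEnergy V xc 0 (fun s y ↦ ψ (T + s) y) atTop :=
      le_iSup (fun T ↦ channelEnergy V xc 0 (fun s y ↦ ψ (T + s) y) atTop) T
    exact tsub_le_iff_right.1 (h2.trans h3)
  -- limit `T → ∞`
  have hlimφ : Tendsto (fun T ↦ totalEnergy V ψ 0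
      + 2 * channelEnergy V xc 0 (fun t x ↦ φ (T + t) x) atTop) atTop
      (𝓝 (totalEnergy V ψ 0 + 2 * totalEnergy V φ 0)) :=
    tendsto_const_nhds.add (ENNReal.Tendsto.const_mul hφlim (Or.inr ENNReal.ofNat_ne_top))
  have hle : totalEnergy V ψ 0 + 2 * totalEnergy V φ 0
      ≤ (⨆ T, channelEnergy V xc 0 (fun s y ↦ ψ (T + s) y) atTop)
        + (2 * totalEnergy V φ 0 + 2 * totalEnergy V w 0) := le_of_tendsto' hlimφ hT
  have hfin : 2 * totalEnergy V φ 0 ≠ ⊤ := ENNReal.mul_ne_top ENNReal.ofNat_ne_top hφE.ne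
  have h4 : totalEnergy V ψ 0 + 2 * totalEnergy V φ 0
      ≤ (⨆ T, channelEnergy V xc 0 (fun s y ↦ ψ (T + s) y) atTop) + 2 * totalEnergy V w 0
        + 2 * totalEnergy V φ 0 := by
    calc _ ≤ _ := hle
      _ = _ := by ring
  have h5 := (ENNReal.add_le_add_iff_right hfin).1 h4
  have h6 : 2 * ENNReal.ofReal ((ε : ℝ) / 2) = ε := by
    rw [← ENNReal.ofReal_ofNat 2, ← ENNReal.ofReal_mul (by norm_num), mul_div_cancel₀ _ two_ne_zero,
      ENNReal.ofReal_coe_nnreal]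
  calc totalEnergy V ψ 0
      ≤ (⨆ T, channelEnergy V xc 0 (fun s y ↦ ψ (T + s) y) atTop) + 2 * totalEnergy V w 0 := h5
    _ ≤ (⨆ T, channelEnergy V xc 0 (fun s y ↦ ψ (T + s) y) atTop) + 2 * ENNReal.ofReal (ε / 2) := by
        gcongr
    _ = _ := by rw [h6]

/-- **Registered summary `stub_h4ExhaustionStability`** (sub-goal of `stub_exhaustionDensity`, crux
stmt-FinalStateConjecture-14075, line `isolated-kerr-connected-hull`): outgoing energy exhaustion passes
from energy-close decompositions `ψ = φ + w` to `ψ`. [folklore] -/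
theorem stub_h4ExhaustionStability :
    ∀ (V : ℝ → ℝ), Differentiable ℝ V → (∀ x, 0 ≤ V x) → ∀ (ψ : ℝ → ℝ → ℝ) (xc : ℝ),
      ReggeWheeler.IsSolution V ψ →
      (∀ ε : ℝ, 0 < ε → ∃ φ w : ℝ → ℝ → ℝ, ReggeWheeler.IsSolution V φ ∧ ReggeWheeler.IsSolution V w ∧
        (∀ t x, ψ t x = φ t x + w t x) ∧ ReggeWheeler.totalEnergy V φ 0 < ⊤ ∧
        ReggeWheeler.totalEnergy V w 0 ≤ ENNReal.ofReal ε ∧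
        Filter.Tendsto (fun T ↦ ReggeWheeler.channelEnergy V xc 0 (fun t x ↦ φ (T + t) x)
          Filter.atTop) Filter.atTop (nhds (ReggeWheeler.totalEnergy V φ 0))) →
      Filter.Tendsto (fun T ↦ ReggeWheeler.channelEnergy V xc 0 (fun t x ↦ ψ (T + t) x)
        Filter.atTop) Filter.atTop (nhds (ReggeWheeler.totalEnergy V ψ 0)) :=
  fun _ hV hV0 _ xc hψ happrox ↦ exhaustion_of_energy_approx hV hV0 hψ xc happrox

end RW

end

end Summit.FinalStateConjecture.FinalStateConjecture.Theorems
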